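import Literature.Geometry.Lorentzian.KillingFlowIsometry
import Literature.Geometry.Lorentzian.CausalityChronologyProofs
import Literature.Geometry.Lorentzian.CausalityClosedProofs
import Literature.Geometry.Lorentzian.StationaryBlackHoleUniquenessProofs
import HarnessLib

/-!
# The past wedge of the far slice region contains a past half of every stationary orbit

For a stationary asymptotically flat black hole `𝓑 : StationaryAFBlackHole` (Chruściel–Costa,
Astérisque 321 (2008), §2: complete stationary Killing field `X₀ = 𝓑.killing`, timelike on
`M_ext = ⋃ₜ φₜ(Σ_ext')`, `Σ_ext' = embed(e.far (e.R + 1))` the embedded far region of the slice's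
asymptotically flat end, domain of outer communications `⟨⟨M_ext⟩⟩ = I⁺(M_ext) ∩ I⁻(M_ext)`) call
**past wedge** the region

  `W := ⟨⟨M_ext⟩⟩ ∩ I⁻(embed(Σ_ext'))`

— the part of the d.o.c. lying to the chronological past of the far slice region.  It is the
region on which the Killing-mode pairs of `Literature.Geometry.Lorentzian.KillingModeStability`
(`StationaryAFBlackHole.IsKillingModePair`, `….IsKillingModeStable`) are required to be bounded
("bounded on the past of the far slice region inside the d.o.c.", i.e. outgoing at infinity).
This file records its basic flow geometry (no new definitions; the set is written out):

* `exists_forall_le_mem_doc_inter_chronologicalPast_of_isMIntegralCurve` — if `σ` is an integral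
  curve of `X₀` with `σ 0 ∈ ⟨⟨M_ext⟩⟩`, there is `t₀` with `σ t ∈ W` for EVERY `t ≤ t₀`: the wedge
  contains a past half of every stationary orbit through the d.o.c.;
* `exists_isMIntegralCurve_forall_le_mem_doc_inter_chronologicalPast` — pointwise corollary
  (completeness of `X₀`): every point of the d.o.c. is carried into `W` by the stationary flow;
* `mem_doc_inter_chronologicalPast_of_isMIntegralCurve_of_nonpos` — `W` is invariant under the
  PAST flow: `σ 0 ∈ W ⟹ σ t ∈ W` for `t ≤ 0`.

Proofs use only §2.2 of Chruściel–Costa: `σ 0 ≪ p` with `p = φᵤ(z)`, `z ∈ embed(Σ_ext')`; the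
flow maps `φₜ` are time-orientation-preserving isometries (`KillingFlowIsometry.lean`:
`IsKillingField.image_flow_chronologicalPast`, `eq_flow_of_isMIntegralCurve`), so
`σ t = φₜ(σ 0) ≪ φₜ(p) = φ_{t+u}(z)`; for `t + u ≤ 0` the orbit segment from `φ_{t+u}(z)` up to
`z` is future timelike because `X₀` is future timelike on `M_ext`; conclude by transitivity of
`≪` (`LorentzianMetric.mem_chronologicalFuture_trans`, O'Neill 1983, Ch. 14, p. 402, applied to
the reversed time orientation).  Consequence (not formalised here): together with the growth law
`|Ψ ∘ φₜ| = e^{νt}|Ψ|` of a Killing-mode pair, boundedness on `W` is automatic orbit by orbit for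
`ν > 0`; the content of the boundedness clause of `IsKillingModePair` is its UNIFORMITY across
orbits (towards spatial and past null infinity, and towards `v → −∞` along the horizon).

## References

* P. T. Chruściel, J. L. Costa, *On uniqueness of stationary vacuum black holes*, Astérisque 321
  (2008) 195–265, arXiv:0806.0016, §2.1–§2.2 ((2.1) `M_ext`, (2.2) `⟨⟨M_ext⟩⟩`, flow invariance).
* B. O'Neill, *Semi-Riemannian geometry with applications to relativity*, Academic Press 1983,
  Ch. 14, p. 402 (transitivity of `≪`), Ch. 9, Prop. 9.23 (flows of Killing fields are isometries).
-/

noncomputable section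

open Bundle Set Filter Function
open scoped Manifold Topology

namespace Literature.Geometry.Lorentzian

universe u

namespace StationaryAFBlackHole

variable {𝓑 : StationaryAFBlackHole.{u}} [𝓑.metric.HasLeviCivita]

/-- **The past wedge contains a past half of every stationary orbit through the d.o.c.**  For an
integral curve `σ` of the stationary Killing field with `σ 0 ∈ ⟨⟨M_ext⟩⟩` there is `t₀ : ℝ` such
that `σ t ∈ ⟨⟨M_ext⟩⟩ ∩ I⁻(embed '' e.far (e.R + 1))` for all `t ≤ t₀`.  Chruściel–Costa 2008,
§2.2 (`M_ext = ⋃ₜ φₜ(Σ_ext)`, `⟨⟨M_ext⟩⟩ = I⁺(M_ext) ∩ I⁻(M_ext)`, invariance under `φₜ`) with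
O'Neill 1983, Ch. 14, p. 402 (transitivity of `≪`). [folklore] -/
theorem exists_forall_le_mem_doc_inter_chronologicalPast_of_isMIntegralCurve {σ : ℝ → 𝓑.carrier}
    (hσ : IsMIntegralCurve σ 𝓑.killing) (h0 : σ 0 ∈ 𝓑.doc) :
    ∃ t₀ : ℝ, ∀ t ≤ t₀, σ t ∈ 𝓑.doc ∩
      𝓑.metric.chronologicalPast 𝓑.timeOrientation (𝓑.embed '' 𝓑.e.far (𝓑.e.R + 1)) := by
  -- the stationary flow `θ` and the regularity of `X₀`
  obtain ⟨θ, hθ, hθ0, hθadd, hθX, -, -, -, -, -, -, -, -⟩ := 𝓑.exists_stationary_flow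
  have hK : 𝓑.metric.IsKillingField 𝓑.killing := 𝓑.isStationaryKilling.isKillingField
  have hK1 : ContMDiff (𝓡 4) (𝓡 4).tangent 1
      (fun x ↦ (⟨x, 𝓑.killing x⟩ : TangentBundle (𝓡 4) 𝓑.carrier)) :=
    hK.contMDiff.of_le (WithTop.coe_le_coe.mpr le_top)
  have hθ2 : ContMDiff (𝓘(ℝ, ℝ).prod (𝓡 4)) (𝓡 4) 2 θ := hθ.of_le (WithTop.coe_le_coe.mpr le_top)
  -- `σ 0 ≪ p` with `p ∈ M_ext`, i.e. `p = ρ u` for an orbit `ρ` starting on the far region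
  have h0' : σ 0 ∈ 𝓑.metric.chronologicalPast 𝓑.timeOrientation 𝓑.Mext := h0.2
  obtain ⟨p, hp, γ, a, b, hab, hγ, hγa, hγb⟩ := h0'
  obtain ⟨ρ, hρ, hρ0, u, hρu⟩ : ∃ ρ : ℝ → 𝓑.carrier, IsMIntegralCurve ρ 𝓑.killing ∧
      ρ 0 ∈ 𝓑.embed '' 𝓑.e.far (𝓑.e.R + 1) ∧ ∃ t, ρ t = p := hp
  -- every point of the orbit `ρ` lies in `M_ext`, where `X₀` is future timelike
  have hρM : ∀ r, ρ r ∈ 𝓑.Mext := fun r ↦ ⟨ρ, hρ, hρ0, r, rfl⟩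
  have hρtl : ∀ s : Set ℝ, 𝓑.metric.IsFutureTimelikeCurveOn 𝓑.timeOrientation ρ s := by
    intro s r _
    exact LorentzianMetric.futureTimelikeAt_of_hasMFDerivAt rfl (hρ r)
      (𝓑.isStationaryKilling.isTimelike (hρM r)).1 (𝓑.isStationaryKilling.isTimelike (hρM r)).2
  refine ⟨-u, fun t ht ↦ ⟨mem_doc_of_isMIntegralCurve hσ h0 t, ?_⟩⟩
  -- `σ t = θₜ(σ 0) ≪ θₜ(p) = ρ (t + u)`
  have hσt : σ t = θ (t, σ 0) := eq_flow_of_isMIntegralCurve hK1 hθX hθ0 hσ t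
  have hpt : θ (t, p) = ρ (t + u) := by
    rw [← hρu, eq_flow_of_isMIntegralCurve hK1 hθX hθ0 hρ u,
      eq_flow_of_isMIntegralCurve hK1 hθX hθ0 hρ (t + u), hθadd]
  have h1 : σ 0 ∈ 𝓑.metric.chronologicalPast 𝓑.timeOrientation {p} :=
    ⟨p, rfl, γ, a, b, hab, hγ, hγa, hγb⟩
  have h2 : σ t ∈ 𝓑.metric.chronologicalPast 𝓑.timeOrientation {ρ (t + u)} := by
    have himg := hK.image_flow_chronologicalPast (τ := 𝓑.timeOrientation) hθ2 hθ0 hθadd hθX t {p}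
    rw [Set.image_singleton, hpt] at himg
    rw [hσt, ← himg]
    exact Set.mem_image_of_mem _ h1
  -- the orbit segment from `ρ (t + u)` to `ρ 0` is future timelike (or trivial)
  rcases (show t + u ≤ 0 by linarith).eq_or_lt with hv | hv
  · rw [hv] at h2
    exact LorentzianMetric.chronologicalFuture_mono (Set.singleton_subset_iff.2 hρ0) h2
  · have h3 : ρ (t + u) ∈ 𝓑.metric.chronologicalPast 𝓑.timeOrientation
        (𝓑.embed '' 𝓑.e.far (𝓑.e.R + 1)) := by
      refine ⟨ρ 0, hρ0, fun r ↦ ρ (t + u + 0 - r), t + u, 0, hv,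
        (hρtl (Icc (t + u) 0)).reverseParam, ?_, ?_⟩
      · simp
      · simp
    exact LorentzianMetric.mem_chronologicalFuture_trans h3 h2

/-- **Every point of the d.o.c. is carried into the past wedge by the stationary flow**: for
`x ∈ ⟨⟨M_ext⟩⟩` there are a whole-line integral curve `σ` of `X₀` with `σ 0 = x` and `t₀` with
`σ t ∈ ⟨⟨M_ext⟩⟩ ∩ I⁻(embed '' e.far (e.R + 1))` for all `t ≤ t₀` (completeness of `X₀` and the
previous theorem).  In particular the wedge meets every stationary orbit of the d.o.c. in a set
unbounded towards the past.  Chruściel–Costa 2008, §2.2. [folklore] -/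
theorem exists_isMIntegralCurve_forall_le_mem_doc_inter_chronologicalPast {x : 𝓑.carrier}
    (hx : x ∈ 𝓑.doc) :
    ∃ σ : ℝ → 𝓑.carrier, IsMIntegralCurve σ 𝓑.killing ∧ σ 0 = x ∧ ∃ t₀ : ℝ, ∀ t ≤ t₀,
      σ t ∈ 𝓑.doc ∩
        𝓑.metric.chronologicalPast 𝓑.timeOrientation (𝓑.embed '' 𝓑.e.far (𝓑.e.R + 1)) := by
  obtain ⟨σ, hσ, hσ0⟩ := 𝓑.isStationaryKilling.isCompleteVectorField x
  exact ⟨σ, hσ, hσ0,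
    exists_forall_le_mem_doc_inter_chronologicalPast_of_isMIntegralCurve hσ (hσ0 ▸ hx)⟩

/-- **The past wedge is invariant under the PAST stationary flow.**  If an integral curve `σ` of
`X₀` starts in the wedge, `σ 0 ∈ ⟨⟨M_ext⟩⟩ ∩ I⁻(embed '' e.far (e.R + 1))`, then `σ t` lies in
the wedge for every `t ≤ 0`: `σ 0 ≪ z` with `z` on the embedded far region, `σ t = φₜ(σ 0) ≪
φₜ(z)`, and the orbit segment from `φₜ(z)` back up to `z` is future timelike inside `M_ext`.
Chruściel–Costa 2008, §2.2; O'Neill 1983, Ch. 14, p. 402. [folklore] -/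
theorem mem_doc_inter_chronologicalPast_of_isMIntegralCurve_of_nonpos {σ : ℝ → 𝓑.carrier}
    (hσ : IsMIntegralCurve σ 𝓑.killing)
    (h0 : σ 0 ∈ 𝓑.doc ∩
      𝓑.metric.chronologicalPast 𝓑.timeOrientation (𝓑.embed '' 𝓑.e.far (𝓑.e.R + 1)))
    {t : ℝ} (ht : t ≤ 0) :
    σ t ∈ 𝓑.doc ∩
      𝓑.metric.chronologicalPast 𝓑.timeOrientation (𝓑.embed '' 𝓑.e.far (𝓑.e.R + 1)) := by
  obtain ⟨θ, hθ, hθ0, hθadd, hθX, -, -, -, -, -, -, -, -⟩ := 𝓑.exists_stationary_flow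
  have hK : 𝓑.metric.IsKillingField 𝓑.killing := 𝓑.isStationaryKilling.isKillingField
  have hK1 : ContMDiff (𝓡 4) (𝓡 4).tangent 1
      (fun x ↦ (⟨x, 𝓑.killing x⟩ : TangentBundle (𝓡 4) 𝓑.carrier)) :=
    hK.contMDiff.of_le (WithTop.coe_le_coe.mpr le_top)
  have hθ2 : ContMDiff (𝓘(ℝ, ℝ).prod (𝓡 4)) (𝓡 4) 2 θ := hθ.of_le (WithTop.coe_le_coe.mpr le_top)
  -- `σ 0 ≪ z` with `z` on the far region; `ρ` the orbit through `z`
  obtain ⟨z, hz, γ, a, b, hab, hγ, hγa, hγb⟩ := h0.2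
  obtain ⟨ρ, hρ, hρ0⟩ := 𝓑.isStationaryKilling.isCompleteVectorField z
  have hρM : ∀ r, ρ r ∈ 𝓑.Mext := fun r ↦ ⟨ρ, hρ, hρ0.symm ▸ hz, r, rfl⟩
  have hρtl : ∀ s : Set ℝ, 𝓑.metric.IsFutureTimelikeCurveOn 𝓑.timeOrientation ρ s := by
    intro s r _
    exact LorentzianMetric.futureTimelikeAt_of_hasMFDerivAt rfl (hρ r)
      (𝓑.isStationaryKilling.isTimelike (hρM r)).1 (𝓑.isStationaryKilling.isTimelike (hρM r)).2
  refine ⟨mem_doc_of_isMIntegralCurve hσ h0.1 t, ?_⟩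
  -- `σ t = θₜ(σ 0) ≪ θₜ(z) = ρ t`
  have hσt : σ t = θ (t, σ 0) := eq_flow_of_isMIntegralCurve hK1 hθX hθ0 hσ t
  have hzt : θ (t, z) = ρ t := by
    rw [← hρ0, eq_flow_of_isMIntegralCurve hK1 hθX hθ0 hρ t, eq_flow_of_isMIntegralCurve hK1 hθX
      hθ0 hρ 0, hθadd, add_zero]
  have h1 : σ 0 ∈ 𝓑.metric.chronologicalPast 𝓑.timeOrientation {z} :=
    ⟨z, rfl, γ, a, b, hab, hγ, hγa, hγb⟩
  have h2 : σ t ∈ 𝓑.metric.chronologicalPast 𝓑.timeOrientation {ρ t} := by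
    have himg := hK.image_flow_chronologicalPast (τ := 𝓑.timeOrientation) hθ2 hθ0 hθadd hθX t {z}
    rw [Set.image_singleton, hzt] at himg
    rw [hσt, ← himg]
    exact Set.mem_image_of_mem _ h1
  have hρ0' : ρ 0 ∈ 𝓑.embed '' 𝓑.e.far (𝓑.e.R + 1) := hρ0.symm ▸ hz
  rcases ht.eq_or_lt with rfl | hv
  · exact LorentzianMetric.chronologicalFuture_mono (Set.singleton_subset_iff.2 hρ0') h2
  · have h3 : ρ t ∈ 𝓑.metric.chronologicalPast 𝓑.timeOrientation
        (𝓑.embed '' 𝓑.e.far (𝓑.e.R + 1)) := by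
      refine ⟨ρ 0, hρ0', fun r ↦ ρ (t + 0 - r), t, 0, hv, (hρtl (Icc t 0)).reverseParam, ?_, ?_⟩
      · simp
      · simp
    exact LorentzianMetric.mem_chronologicalFuture_trans h3 h2

end StationaryAFBlackHole

end Literature.Geometry.Lorentzian

end
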